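import Summits.AtomisticToContinuum.Crystallization.Theorems.FreeSplittingCertificatesStrictSplittingRuleP1FarCellShare

/-!
# `StrictSplittingRule` (stmt-AtomisticToContinuum-12560): THE CELLS AROUND A LOADED LEG — carrier tables of the quarter triangulation, and the capacity of a far leg from them (P1 interpolant object, part 86)

Route `FreeSplittingCertificates`, crux r3 `StrictSplittingRule` (H12⋆ = `stub_coreJointCoercive`), unit b2b-freesplit-B gen 38.
VALUE = third brick of the (B∃) TAIL LEMMA.  The readout legs of the far budget are the in-layer stencil edges `(x, d)`, `d ∈ p1StencilIn`,
and the slanted route legs `(x, d)`, `d ∈ p1RouteDirs (parity of x)` (first leg of the vertical bond at `x`, second leg of the vertical bond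
arriving at `x + d`).  Around each such leg sit `4` or `6` cells of the P1 chart (2 tetrahedra + 1 or 2 quarters of each of the two
octahedra); this file tabulates them (translation-invariantly, as (corner offset, piece) pairs relative to `x`) and derives the capacity bound
`Σ_{T' ∋ e} J_{T'} ≥ n·|T'|·(R + ϱ)⁻⁶` of part 85 for every loaded leg with an endpoint at distance `R` from `y_p`:
* `parOf`, `p1Par_sub_corner` / `p1Par_add` (parities of neighbouring cubes and sites), `p1RouteDirs`, `p1RouteOff_mem_dirs`,
  `sum_ite_eq_routeOff_le_one`, `sum_ite_routeOff_eq_le_one`, `mem_dirs_of_routeOff_back` (the route indicators of hypothesis (B∃));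
* `p1LoadDirs`, **`p1Carriers`** (the table; `p1Carriers_valid` by `decide`: every listed cell has `x` and `x + d` as vertices), the twelve cardinalities;
* **`cap_ge_carriers`** — `(p1Carriers b d).card · (√3a²h/12)·((R + ϱ)²)⁻³ ≤ p1CapJ p (x, d)` for `R = ‖y_z − y_p‖`, `z ∈ {x, x + d}`.
NOT a proof of H12⋆, NOT summit progress.  [folklore]
-/

noncomputable section

open Set Function Metric MeasureTheory Filter Topology
open scoped BigOperators NNReal ENNReal Classical

namespace Summit.AtomisticToContinuum.Crystallization.Theorems.StrictSplittingRuleBirth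

open Literature.MathematicalPhysics.StatisticalMechanics
open Summit.AtomisticToContinuum.Crystallization.Theorems.PalmUnimodularRigidity.LayeredLawsSelectHcp

/-! ## Parities -/

/-- The cube-layer parity of `x − o` (or of `x + o`) from the parity `b` of `x`: unchanged iff `o.1` is even. [folklore] -/
def parOf (b : Bool) (o : ℤ × ℤ × ℤ) : Bool := if Even o.1 then b else !b

/-- `p1Par (x − o) = parOf (p1Par x) o`. -/
theorem p1Par_sub (x o : ℤ × ℤ × ℤ) : p1Par (x - o) = parOf (p1Par x) o := by
  unfold p1Par parOf
  have h1 : (x - o).1 = x.1 - o.1 := rfl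
  rw [h1]
  by_cases hx : Even x.1 <;> by_cases ho : Even o.1 <;> simp [hx, ho, Int.even_sub]

/-- `p1Par (x + o) = parOf (p1Par x) o`. -/
theorem p1Par_add (x o : ℤ × ℤ × ℤ) : p1Par (x + o) = parOf (p1Par x) o := by
  unfold p1Par parOf
  have h1 : (x + o).1 = x.1 + o.1 := rfl
  rw [h1]
  by_cases hx : Even x.1 <;> by_cases ho : Even o.1 <;> simp [hx, ho, Int.even_add]

/-! ## The route directions -/

/-- The three slanted route directions from a site of parity `b` (`p1RouteOff`, part 63): `{(1,0,0),(1,−1,0),(1,0,−1)}` (even) /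
`{(1,0,0),(1,1,0),(1,0,1)}` (odd). [folklore] -/
def p1RouteDirs (b : Bool) : Finset (ℤ × ℤ × ℤ) :=
  if b then {(1, 0, 0), (1, -1, 0), (1, 0, -1)} else {(1, 0, 0), (1, 1, 0), (1, 0, 1)}

/-- Every routing offset of `x` is a route direction of the parity of `x`. -/
theorem p1RouteOff_mem_dirs (x : ℤ × ℤ × ℤ) (i : Fin 3) : p1RouteOff x i ∈ p1RouteDirs (p1Par x) := by
  unfold p1RouteOff p1RouteDirs p1Par
  by_cases hx : Even x.1
  · simp only [hx, ↓reduceIte, decide_true]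
    fin_cases i <;> simp
  · simp only [hx, ↓reduceIte, decide_false, Bool.false_eq_true]
    fin_cases i <;> simp

/-- The routing offsets of a site are pairwise distinct. -/
theorem p1RouteOff_injective (x : ℤ × ℤ × ℤ) : Function.Injective (p1RouteOff x) := by
  unfold p1RouteOff
  by_cases hx : Even x.1
  · simp only [hx, ↓reduceIte]; decide
  · simp only [hx, ↓reduceIte]; decide

/-- At most one routing offset of `x` equals a given vector: `Σ_i [d = p1RouteOff x i] ≤ 1`. -/
theorem sum_ite_eq_routeOff_le_one (x d : ℤ × ℤ × ℤ) : ∑ i : Fin 3, (if d = p1RouteOff x i then (1 : ℝ) else 0) ≤ 1 := by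
  rw [Finset.sum_boole]
  have : (Finset.univ.filter fun i : Fin 3 => d = p1RouteOff x i).card ≤ 1 := by
    refine Finset.card_le_one.2 fun i hi j hj => ?_
    simp only [Finset.mem_filter, Finset.mem_univ, true_and] at hi hj
    exact p1RouteOff_injective x (hi.symm.trans hj)
  exact_mod_cast this

/-- At most one routing offset of `q` equals a given vector: `Σ_i [p1RouteOff q i = s] ≤ 1`. -/
theorem sum_ite_routeOff_eq_le_one (q s : ℤ × ℤ × ℤ) : ∑ i : Fin 3, (if p1RouteOff q i = s then (1 : ℝ) else 0) ≤ 1 := by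
  have h := sum_ite_eq_routeOff_le_one q s
  refine le_of_eq_of_le (Finset.sum_congr rfl fun i _ => ?_) h
  by_cases hi : p1RouteOff q i = s
  · rw [if_pos hi, if_pos hi.symm]
  · rw [if_neg hi, if_neg (Ne.symm hi)]

/-- The second-leg indicator of hypothesis (B∃) fires only on route directions of the parity of the leg's tail:
`p1RouteOff (x − (SV − d)) i = SV − d → d ∈ p1RouteDirs (p1Par x)`. -/
theorem mem_dirs_of_routeOff_back {x d : ℤ × ℤ × ℤ} {i : Fin 3} (h : p1RouteOff (x - (p1SV - d)) i = p1SV - d) :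
    d ∈ p1RouteDirs (p1Par x) := by
  have hmem := p1RouteOff_mem_dirs (x - (p1SV - d)) i
  rw [h] at hmem
  -- the first coordinate of a route direction is `1`, so `d.1 = 1` and the base has the other parity
  have hd1 : d.1 = 1 := by
    have h1 : (p1SV - d).1 = 1 := by
      unfold p1RouteDirs at hmem
      split_ifs at hmem <;> simp only [Finset.mem_insert, Finset.mem_singleton] at hmem <;>
        rcases hmem with hh | hh | hh <;> exact (congrArg Prod.fst hh).trans rfl
    have : (p1SV - d).1 = 2 - d.1 := rfl
    simp only [p1SV] at this h1
    omega
  have hpar : p1Par (x - (p1SV - d)) = !p1Par x := by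
    unfold p1Par
    have h1 : (x - (p1SV - d)).1 = x.1 - 1 := by
      show x.1 - ((2 : ℤ) - d.1) = x.1 - 1
      omega
    rw [h1]
    have he : Even (x.1 - 1) ↔ ¬Even x.1 := Int.even_sub_one
    by_cases hx : Even x.1 <;> simp [hx, he]
  rw [hpar] at hmem
  have key : ∀ b : Bool, ∀ r ∈ p1RouteDirs (!b), p1SV - r ∈ p1RouteDirs b := by decide
  have := key (p1Par x) (p1SV - d) hmem
  rwa [sub_sub_cancel] at this

/-! ## The carrier tables -/

/-- The eight loaded leg directions: the in-layer stencil `(0,1,0),(0,0,1),(0,−1,1)` and the route directions of both parities. [folklore] -/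
def p1LoadDirs : Finset (ℤ × ℤ × ℤ) := {(0, 1, 0), (0, 0, 1), (0, -1, 1), (1, 0, 0), (1, -1, 0), (1, 0, -1), (1, 1, 0), (1, 0, 1)}

/-- **THE CELLS AROUND A LOADED LEG** `(x, d)`, `x` of parity `b`, as (corner offset `o`, piece `π`) pairs: the cell is `(x − o, π)` (2 tetrahedra
+ 1 or 2 quarters of each adjacent octahedron; `∅` for unloaded directions). [folklore] -/
def p1Carriers (b : Bool) (d : ℤ × ℤ × ℤ) : Finset ((ℤ × ℤ × ℤ) × Fin 6) :=
  if b then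
    if d = (0, 1, 0) then {((0, 0, 0), 0), ((0, 0, 1), 2), ((0, 0, 1), 5), ((1, 0, 0), 0), ((1, 0, 1), 2), ((1, 0, 1), 5)}
    else if d = (0, 0, 1) then {((0, 0, 0), 0), ((0, 1, 0), 2), ((1, 0, 0), 0), ((1, 1, 0), 2)}
    else if d = (0, -1, 1) then {((0, 1, 0), 0), ((0, 1, 0), 2), ((0, 1, 0), 3), ((1, 1, 0), 0), ((1, 1, 0), 2), ((1, 1, 0), 3)}
    else if d = (1, 0, 0) then {((0, 0, 0), 0), ((0, 1, 1), 1), ((0, 1, 0), 2), ((0, 1, 0), 3), ((0, 0, 1), 4), ((0, 0, 1), 5)}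
    else if d = (1, -1, 0) then {((0, 1, 0), 0), ((0, 1, 1), 1), ((0, 1, 0), 3), ((0, 1, 1), 5)}
    else if d = (1, 0, -1) then {((0, 0, 1), 0), ((0, 1, 1), 1), ((0, 1, 1), 2), ((0, 0, 1), 3), ((0, 0, 1), 4), ((0, 1, 1), 5)}
    else ∅
  else
    if d = (0, 1, 0) then {((1, 0, 1), 1), ((1, 0, 0), 3), ((1, 0, 0), 4), ((0, 0, 1), 1), ((0, 0, 0), 3), ((0, 0, 0), 4)}
    else if d = (0, 0, 1) then {((1, 1, 0), 1), ((1, 0, 0), 4), ((0, 1, 0), 1), ((0, 0, 0), 4)}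
    else if d = (0, -1, 1) then {((1, 1, 0), 1), ((1, 1, 0), 4), ((1, 1, 0), 5), ((0, 1, 0), 1), ((0, 1, 0), 4), ((0, 1, 0), 5)}
    else if d = (1, 0, 0) then {((0, 0, 0), 0), ((0, 1, 1), 1), ((0, 1, 0), 2), ((0, 1, 0), 3), ((0, 0, 1), 4), ((0, 0, 1), 5)}
    else if d = (1, 1, 0) then {((0, 0, 0), 0), ((0, 0, 1), 1), ((0, 0, 0), 3), ((0, 0, 1), 5)}
    else if d = (1, 0, 1) then {((0, 0, 0), 0), ((0, 1, 0), 1), ((0, 1, 0), 2), ((0, 0, 0), 3), ((0, 0, 0), 4), ((0, 1, 0), 5)}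
    else ∅

/-- Outside the loaded directions the table is empty. -/
theorem p1Carriers_eq_empty (b : Bool) {d : ℤ × ℤ × ℤ} (hd : d ∉ p1LoadDirs) : p1Carriers b d = ∅ := by
  simp only [p1LoadDirs, Finset.mem_insert, Finset.mem_singleton, not_or] at hd
  obtain ⟨h1, h2, h3, h4, h5, h6, h7, h8⟩ := hd
  unfold p1Carriers
  cases b <;> simp [h1, h2, h3, h4, h5, h6, h7, h8]

/-- **Validity of the table** (by `decide`): every listed cell `(x − o, π)` has `x` and `x + d` as vertices. -/
theorem p1Carriers_valid_of_mem : ∀ b : Bool, ∀ d ∈ p1LoadDirs, ∀ oπ ∈ p1Carriers b d,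
    ∃ m m' : Fin 4, p1VertOff (parOf b oπ.1) oπ.2 m = oπ.1 ∧ p1VertOff (parOf b oπ.1) oπ.2 m' = oπ.1 + d := by
  decide

/-- Validity of the table for every direction (empty table otherwise). -/
theorem p1Carriers_valid (b : Bool) (d : ℤ × ℤ × ℤ) : ∀ oπ ∈ p1Carriers b d,
    ∃ m m' : Fin 4, p1VertOff (parOf b oπ.1) oπ.2 m = oπ.1 ∧ p1VertOff (parOf b oπ.1) oπ.2 m' = oπ.1 + d := by
  by_cases hd : d ∈ p1LoadDirs
  · exact p1Carriers_valid_of_mem b d hd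
  · rw [p1Carriers_eq_empty b hd]; simp

/-- Cardinalities of the table (in-layer `6, 4, 6`; slanted `6, 4, 6`; both parities). -/
theorem p1Carriers_card :
    (p1Carriers true (0, 1, 0)).card = 6 ∧ (p1Carriers true (0, 0, 1)).card = 4 ∧ (p1Carriers true (0, -1, 1)).card = 6 ∧
    (p1Carriers true (1, 0, 0)).card = 6 ∧ (p1Carriers true (1, -1, 0)).card = 4 ∧ (p1Carriers true (1, 0, -1)).card = 6 ∧
    (p1Carriers false (0, 1, 0)).card = 6 ∧ (p1Carriers false (0, 0, 1)).card = 4 ∧ (p1Carriers false (0, -1, 1)).card = 6 ∧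
    (p1Carriers false (1, 0, 0)).card = 6 ∧ (p1Carriers false (1, 1, 0)).card = 4 ∧ (p1Carriers false (1, 0, 1)).card = 6 := by
  decide

/-! ## The capacity of a loaded leg from the table -/

/-- **CAPACITY OF A LEG FROM ITS CARRIERS**: for a leg `(x, d)` with `x` of parity `b` and an endpoint `z ∈ {x, x + d}` at distance
`R = ‖y_z − y_p‖ ≥ 27a/5 + ϱ` (`ϱ = √(4a²/3 + h²)`): `(p1Carriers b d).card · (√3a²h/12)·((R + ϱ)²)⁻³ ≤ Σ_{T' ∋ (x,d)} J_{T'}`. [folklore] -/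
theorem cap_ge_carriers {a h : ℝ} (ha : 0 < a) (hh : 0 < h) (p x d : ℤ × ℤ × ℤ) {b : Bool} (hb : p1Par x = b) {z : ℤ × ℤ × ℤ}
    (hz : z = x ∨ z = x + d) (hR : 27 / 5 * a + √(4 * a ^ 2 / 3 + h ^ 2) ≤ ‖hcpSite a h z - hcpSite a h p‖) :
    ((p1Carriers b d).card : ℝ) * (√3 * a ^ 2 * h / 12 * (((‖hcpSite a h z - hcpSite a h p‖ + √(4 * a ^ 2 / 3 + h ^ 2)) ^ 2)⁻¹) ^ 3) ≤
      p1CapJ a h p (x, d) := by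
  set f : (ℤ × ℤ × ℤ) × Fin 6 → (ℤ × ℤ × ℤ) × Fin 6 := fun oπ => (x - oπ.1, oπ.2) with hf
  have hinj : Function.Injective f := by
    intro u v huv
    simp only [hf, Prod.mk.injEq, sub_right_inj] at huv
    exact Prod.ext huv.1 huv.2
  set C := (p1Carriers b d).image f with hC
  have hcard : C.card = (p1Carriers b d).card := Finset.card_image_of_injective _ hinj
  -- every listed cell carries the leg
  have hval := p1Carriers_valid b d
  have hedge : ∀ T' ∈ C, ((x, d) : (ℤ × ℤ × ℤ) × (ℤ × ℤ × ℤ)) ∈ p1EdgeSet T' := by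
    intro T' hT'
    rw [hC, Finset.mem_image] at hT'
    obtain ⟨oπ, hoπ, rfl⟩ := hT'
    obtain ⟨m, m', h1, h2⟩ := hval oπ hoπ
    have hpar : p1Par (x - oπ.1) = parOf b oπ.1 := by rw [p1Par_sub, hb]
    rw [mem_p1EdgeSet_iff]
    refine ⟨m, m', ?_, ?_⟩
    · show x = (x - oπ.1) + p1VertOff (p1Par (x - oπ.1)) oπ.2 m
      rw [hpar, h1]; abel
    · show x + d = (x - oπ.1) + p1VertOff (p1Par (x - oπ.1)) oπ.2 m'
      rw [hpar, h2]; abel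
  -- every listed cell has `z` as a vertex, hence the bound of part 85
  set V : ℝ := √3 * a ^ 2 * h / 12 * (((‖hcpSite a h z - hcpSite a h p‖ + √(4 * a ^ 2 / 3 + h ^ 2)) ^ 2)⁻¹) ^ 3 with hV
  have hJ : ∀ T' ∈ C, V ≤ p1CellJ a h p T' := by
    intro T' hT'
    rw [hC, Finset.mem_image] at hT'
    obtain ⟨oπ, hoπ, rfl⟩ := hT'
    obtain ⟨m, m', h1, h2⟩ := hval oπ hoπ
    rcases hz with hzx | hzx
    · -- centre `x`: the cell is `(z − o, π)` with vertex `m` at `o`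
      have hpar : p1Par (z - oπ.1) = parOf b oπ.1 := by rw [hzx, p1Par_sub, hb]
      have hv : p1VertOff (p1Par (z - oπ.1)) oπ.2 m = oπ.1 := by rw [hpar, h1]
      have ho : oπ.1 ∈ p1Corners := h1 ▸ p1VertOff_mem_p1Corners _ _ _
      have := p1CellJ_ge_of_vertex ha hh p z ho hv hR
      have hzo' : z - oπ.1 = x - oπ.1 := by rw [hzx]
      rw [hzo'] at this
      exact this
    · -- centre `x + d`: the cell is `(z − (o + d), π)` with vertex `m'` at `o + d`
      have hzo : z - (oπ.1 + d) = x - oπ.1 := by rw [hzx]; abel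
      have hpar : p1Par (z - (oπ.1 + d)) = parOf b oπ.1 := by rw [hzo, p1Par_sub, hb]
      have hv : p1VertOff (p1Par (z - (oπ.1 + d))) oπ.2 m' = oπ.1 + d := by rw [hpar, h2]
      have ho : oπ.1 + d ∈ p1Corners := h2 ▸ p1VertOff_mem_p1Corners _ _ _
      have := p1CellJ_ge_of_vertex ha hh p z ho hv hR
      rw [hzo] at this
      exact this
  calc ((p1Carriers b d).card : ℝ) * V = ∑ _T' ∈ C, V := by rw [Finset.sum_const, hcard, nsmul_eq_mul]
    _ ≤ ∑ T' ∈ C, p1CellJ a h p T' := Finset.sum_le_sum hJ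
    _ ≤ p1CapJ a h p (x, d) := sum_le_p1CapJ a h p (x, d) C hedge

end Summit.AtomisticToContinuum.Crystallization.Theorems.StrictSplittingRuleBirth

end
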